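import Literature.NumberTheory.EllipticCurves.Muller2020.MainConjectureSplitTwo
import Literature.NumberTheory.EllipticCurves.DeShalit1987.KatzMeasureMonomialLinesFrames
import Literature.NumberTheory.EllipticCurves.DeShalit1987.KatzMeasureUnitTwistRing
import HarnessLib

/-!
# Change of modulus along a `ℤ_p`-line for the `ν(𝔤)`-branches: multiplying by the Euler factor at one
# more place `w` (de Shalit 1987, II Thm. 4.12 (ii) (32); Müller 2020, §2 (2.21)) — PROVED, given the
# `p`-adic avatar dictionary at `w` (displayed)

Topic `Literature/NumberTheory/EllipticCurves` (grouping sub-namespace `Muller2020`), sequel of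
`Muller2020/MainConjectureSplitTwo.lean` (the predicate `Muller2020.IsNuBranch`). THEOREMS ONLY (no
definition, no named fact, no `sorry`, no `instance`). Typed by the discharge-interface typer
`bsd-print-cf2-ty2` (cell `bsd-print-cf2`) as the ALGEBRAIC half of input **(A)** of the planner's
M-LINE-PIN on crux `PrintCf2RubinValueTwo.TwoVariableMainConjAtSplitTwoQuad`
(stmt-BirchSwinnertonDyer-24033; memo `Cruxes/TwoVariableMainConjAtSplitTwo/M-LINE-PIN-cf2c-w8g3.md`
§3: "`π_v(G₂) = E_v̄ · G₁`", and this seat's `CTL-NOTE-Tb-Muller2020-Thm13-g35.md` §3). HONEST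
FRAMING: nothing here concerns an elliptic curve over `ℚ`; BSD is not proved by any of this.

## The printed statement

de Shalit 1987, II Thm. 4.12 (ii) (store chunk 66–67): for `𝔣 ∣ 𝔤` prime to `𝔭`, "(32)
`μ(𝔤)|_{𝒢(𝔣)} = ∏_{𝔩∣𝔤, 𝔩∤𝔣} (1 − σ_𝔩⁻¹) · μ(𝔣)`" (restriction of the measure of the larger modulus
is the measure of the smaller modulus times the Euler factors at the new primes); Müller 2020, §2
(arXiv:2002.05647 p0006:L31–36; Diss. (2.21) p0039) defines `ν(𝔤)` from `ν(𝔣)` by exactly this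
formula. In the "power series language" II.4.16 (49)–(50) along a `ℤ_p`-line `κ` (generator `γ`,
`1 + T ↔ γ`) this reads: if `G` interpolates `L_{p,𝔤}(λρ)` (Euler factors removed at `T = supp 𝔤`)
then `E_w · G` interpolates `L_{p,𝔤w}(λρ)` (Euler factors removed at `T ∪ {w}`), where
`E_w(T) = 1 − (λρ)(ϖ_w)` READ AS A FUNCTION OF THE POINT: `(λρ)(ϖ_w) = λ(ϖ_w)·ρ(ϖ_w)` and, `ρ̂`
factoring through `Γ_κ ≅ ℤ_p` with `Frob_w ↦ γ^{c}` (`c = κ(Frob_w)`), `ι⁻¹ρ(ϖ_w) = r(Frob_w) =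
(1 + (r(γ) − 1))^{c}` (`ZpExtension.avatarValueAt_eq_onePlusPow`), so `E_w = 1 − a·(1+T)^{c}` with
`a = ι⁻¹λ(ϖ_w)` — the tree's `IntSeries.binomPow`.

## What is proved, and what is displayed

`IsNuBranch.insert_of_avatarAt` (and its POINTWISE form
`IsNuBranch.hasValueAt_insert_of_avatarAt`, which needs the dictionary only at the given unramified
point — the form a rigidity argument uses): for `G` an `IsNuBranch ι v T κ γ λ Ω Ω_p` solution with
`γ` a topological generator, `w ∉ T`, an element `φ ∈ Γ_K` and a constant `a ∈ 𝒪_{ℂ_p}`, IF at every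
interpolation point of the LARGER range (`ε = λρ` of type `(−m,0)` unramified outside `T ∪ {w}`) the
AVATAR DICTIONARY AT `w` holds in the form «`ε` is unramified at `w` and `ι⁻¹(ε(ϖ_w)) = a · r(φ)`»
(hypothesis `hdict`, DISPLAYED), then `(1 − C a · binomPow (κ φ)) · G` is an
`IsNuBranch ι v (insert w T) κ γ λ Ω Ω_p` solution. Proof: `removedEulerFactorsAtZero_insert`, the
avatar identity `r(φ) = (1 + (r(γ)−1))^{κ φ}` and the Cauchy product `IntSeries.HasValueAt.mul` on the
open disc (`‖r(γ) − 1‖ < 1`, `ZpExtension.norm_avatarValueAt_sub_one_lt`). The variant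
`IsNuBranch.insert_of_avatarAt_inv` reads the branch at the INVERSE generator `γ⁻¹` (the orientation of
`Muller2020.thm13_exists_nuBranch_charIdeal_eq` and of `Rubin1991.thm41_exists_katzMeasure₂_charIdeal_eq`),
via the `(−1)`-twisted quotient `κ.unitTwist (−1)` for which `γ⁻¹` is a generator
(`isNuBranch_unitTwist_iff`: the predicate depends on `κ` only through `ker κ`).

WHY `hdict` IS DISPLAYED AND NOT PROVED: for the cell's use `w = v̄ ∣ p` (the OTHER prime above `p`
on the `v`-line), and the tree's avatar predicates `IsPAdicAvatarOf ι ρ r` / `DeShalit1987.IsPAdicAvatarOutside`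
pin `r` only at places NOT above `p` (hypothesis `(p : 𝓞 K) ∉ v.asIdeal`); that `r` is unramified at
`v̄` with `r(Frob_v̄^{geom}) = ι⁻¹ρ(ϖ_v̄)` for `ρ` of type `(a, 0)` (exponent `0` at the embedding
inducing `v̄`) unramified at `v̄` is Serre's local description of locally algebraic abelian
representations at a place of weight `0` — in print (Serre 1968, III §A.4–A.5 with II §2.7), not in
the tree. For `w ∤ p` the hypothesis follows from `IsPAdicAvatarOf` itself (`r.HasFrobCharpolyAt w`)
once a Frobenius element `φ` is fixed; that bookkeeping (`HasFrobCharpolyAt ↦ avatarValueAt`) is the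
consumer's. With `hdict` discharged, the remaining analytic input of (A) is the PERIOD-PAIR rigidity
between two `IsNuBranch ι v (insert v̄ S) κ γ λ` solutions (`DeShalit1987/KatzBranchRigidity.lean`,
`IntSeriesNodeTransport.lean`).

## References
* [deShalit1987] II Thm. 4.12 (ii) (32) (store chunk 66–67), II.4.16 (49)–(50) (store chunk 76–77),
  II.4.17 (52)–(53) (store chunk 77–78).
* [Muller2020SplitPrimeTwo] §2, the pseudo-measures `ν(𝔤)` (arXiv p0006:L31–36); [Muller2021SplitPrimeThesis]
  (2.21) (p0039).
* [SerreAbelianLadic1968] Ch. II §2.7, Ch. III §A (locally algebraic characters) — the displayed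
  dictionary at `w ∣ p`.
* Tree: `Muller2020/MainConjectureSplitTwo.lean` (`IsNuBranch`, `interpolationValue₀`);
  `DeShalit1987/KatzMeasureMonomialLinesPAdic.lean` (`IntSeries.binomPow`, `onePlusPow`,
  `hasValueAt_binomPow`); `DeShalit1987/KatzMeasureMonomialLines.lean` (`IntSeries.HasValueAt.mul`);
  `DeShalit1987/KatzMeasureUnitTwistRing.lean` (`IntSeries.hasValueAt_C`, `hasValueAt_one`);
  `DeShalit1987/KatzMeasureMonomialLinesFrames.lean` (`ZpExtension.avatarValueAt_eq_onePlusPow`,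
  `norm_avatarValueAt_sub_one_lt`); `DeShalit1987/KatzPAdicLFunction.lean`
  (`removedEulerFactorsAtZero_insert`).
-/

noncomputable section

open scoped Classical
open NumberField IsDedekindDomain Field Polynomial
open Literature.NumberTheory.GaloisRepresentations
open Literature.NumberTheory.EllipticCurves.GreenbergVatsal2000

namespace Literature.NumberTheory.EllipticCurves.Muller2020

universe u

variable {p : ℕ} [Fact p.Prime] {K : Type u} [Field K] [NumberField K]

/-! ### §1. Plumbing: the value of `1 − C a · binomPow c`, the interpolation value at one more place -/

/-- **The Euler-factor series `E = 1 − C a · (1+T)^c` has value `1 − a·(1+x)^c` at `x`** (`‖x‖ < 1`).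
[cite: deShalit1987, II Thm. 4.12 (ii) (32) (store chunk 67)] [cite: Koblitz1984, Ch. IV §1] -/
theorem hasValueAt_one_sub_C_mul_binomPow (a : PadicComplexInt p) (c : ℤ_[p]) {x : ℂ_[p]}
    (hx : ‖x‖ < 1) :
    IntSeries.HasValueAt (1 - PowerSeries.C a * IntSeries.binomPow c) x
      (1 - (a : ℂ_[p]) * IntSeries.onePlusPow c x) := by
  have h1 : IntSeries.HasValueAt (1 : PowerSeries (PadicComplexInt p)) x 1 := IntSeries.hasValueAt_one x
  have h2 : IntSeries.HasValueAt (PowerSeries.C a * IntSeries.binomPow c) x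
      ((a : ℂ_[p]) * IntSeries.onePlusPow c x) :=
    IntSeries.HasValueAt.mul hx (IntSeries.hasValueAt_C a x) (IntSeries.hasValueAt_binomPow c hx)
  unfold IntSeries.HasValueAt at h1 h2 ⊢
  simpa [map_sub, sub_mul] using h1.sub h2

omit [Fact p.Prime] in
/-- Adding one place `w ∉ T` to the removed set multiplies the interpolation value by the Euler
factor `1 − ε(ϖ_w)` (de Shalit's (32) at one interpolation point).
[cite: deShalit1987, II Thm. 4.12 (ii) (32) (store chunk 67) and II.1.1 (store chunk 32)] -/
theorem interpolationValue₀_insert (v : HeightOneSpectrum (𝓞 K)) {w : HeightOneSpectrum (𝓞 K)}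
    {T : Finset (HeightOneSpectrum (𝓞 K))} (hw : w ∉ T) (ε : HeckeCharacter K) (m : ℕ)
    (Ω Lval : ℂ) :
    interpolationValue₀ p v (insert w T) ε m Ω Lval =
      (1 - heckeValueExtZero ε w) * interpolationValue₀ p v T ε m Ω Lval := by
  unfold interpolationValue₀
  rw [DeShalit1987.removedEulerFactorsAtZero_insert ε hw]
  ring

/-! ### §2. The predicate depends on `κ` only through `ker κ`; the inverse generator -/

section Twist

variable {ι : PadicAlgCl p ≃+* ℂ} {v : HeightOneSpectrum (𝓞 K)} {T : Finset (HeightOneSpectrum (𝓞 K))}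
  {κ : ZpExtension K p} {γ : absoluteGaloisGroup K} {lam : HeckeCharacter K} {Ω : ℂ} {Ωp : ℂ_[p]}
  {G : PowerSeries (PadicComplexInt p)}

omit [NumberField K] in
/-- `FactorsThroughZp` sees only `ker κ`, which a unit twist does not change.
[cite: deShalit1987, II.4.17 (52)–(53) (store chunk 77–78)] -/
theorem factorsThroughZp_unitTwist_iff {A : Type*} [CommRing A] [TopologicalSpace A] (u : ℤ_[p]ˣ)
    (r : FramedGaloisRep K A 1) :
    FactorsThroughZp (κ.unitTwist u) r ↔ FactorsThroughZp κ r := by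
  have h1 : ∀ σ : absoluteGaloisGroup K, (κ.unitTwist u) σ = 1 ↔ κ σ = 1 := fun σ ↦ by
    rw [← ZpExtension.mem_kerSubgroup, ← ZpExtension.mem_kerSubgroup,
      ZpExtension.kerSubgroup_unitTwist]
  simp only [FactorsThroughZp, h1]

/-- **`IsNuBranch` depends on `κ` only through `ker κ`**: a unit twist of the `ℤ_p`-quotient does not
change the predicate (the line and the evaluation point `r(γ) − 1` are the same).
[cite: deShalit1987, II.4.17 (52)–(53) (store chunk 77–78)] -/
theorem isNuBranch_unitTwist_iff (u : ℤ_[p]ˣ) :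
    IsNuBranch ι v T (κ.unitTwist u) γ lam Ω Ωp G ↔ IsNuBranch ι v T κ γ lam Ω Ωp G := by
  simp only [IsNuBranch, factorsThroughZp_unitTwist_iff]

omit [NumberField K] in
/-- `γ⁻¹` is a topological generator of the `(−1)`-twisted quotient when `γ` is one of `κ`.
[cite: deShalit1987, II.4.17 (54) (store chunk 78)] -/
theorem _root_.Literature.NumberTheory.EllipticCurves.ZpExtension.IsTopGenerator.unitTwist_neg_one_inv
    (hγ : κ.IsTopGenerator γ) : (κ.unitTwist (-1)).IsTopGenerator γ⁻¹ := by
  rw [ZpExtension.IsTopGenerator] at hγ ⊢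
  rw [ZpExtension.unitTwist_apply, map_inv, hγ]
  simp

end Twist

/-! ### §3. The Euler factor at one more place, given the avatar dictionary there -/

section Euler

variable {ι : PadicAlgCl p ≃+* ℂ} {v w : HeightOneSpectrum (𝓞 K)} {T : Finset (HeightOneSpectrum (𝓞 K))}
  {κ : ZpExtension K p} {γ : absoluteGaloisGroup K} {lam : HeckeCharacter K} {Ω : ℂ} {Ωp : ℂ_[p]}
  {G : PowerSeries (PadicComplexInt p)}

/-- **de Shalit II.4.12 (ii) (32) along the line, at a topological generator: `(1 − a(1+T)^{κφ})·G` is a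
`ν(𝔤w)`-branch when `G` is a `ν(𝔤)`-branch**, GIVEN the avatar dictionary at `w` on the larger range
(`hdict`: every `ε = λρ` of type `(−m,0)` unramified outside `T ∪ {w}` with `ρ̂` through `κ` is
unramified at `w` and `ι⁻¹ε(ϖ_w) = a·r(φ)` — displayed; see the module docstring for why).
[cite: deShalit1987, II Thm. 4.12 (ii) (32) (store chunk 66–67), II.4.16 (49)–(50) (store chunk 76–77)]
[cite: Muller2020SplitPrimeTwo, §2 ν(𝔤) (arXiv p0006:L31–36)] -/
theorem IsNuBranch.insert_of_avatarAt (hG : IsNuBranch ι v T κ γ lam Ω Ωp G)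
    (hγ : κ.IsTopGenerator γ) (hw : w ∉ T) (φ : absoluteGaloisGroup K) (a : PadicComplexInt p)
    (hdict : ∀ (ρ : HeckeCharacter K) (r : FramedGaloisRep K (PadicAlgCl p) 1) (m : ℕ),
      IsPAdicAvatarOf ι ρ r → FactorsThroughZp κ r → 0 < m →
      (lam * ρ).HasInfinityType (fun _ ↦ -(m : ℤ)) (fun _ ↦ (0 : ℤ)) →
      (∀ w' : HeightOneSpectrum (𝓞 K), w' ∉ insert w T → (lam * ρ).IsUnramifiedAt w') →
      (lam * ρ).IsUnramifiedAt w ∧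
        ((ι.symm (heckeValueExtZero (lam * ρ) w) : PadicAlgCl p) : ℂ_[p]) =
          (a : ℂ_[p]) * avatarValueAt r φ) :
    IsNuBranch ι v (insert w T) κ γ lam Ω Ωp
      ((1 - PowerSeries.C a * IntSeries.binomPow (Multiplicative.toAdd (κ φ))) * G) := by
  intro ρ r m hr hκ hm hinf hunr hL
  obtain ⟨hunrw, hval⟩ := hdict ρ r m hr hκ hm hinf hunr
  have hunr' : ∀ w' : HeightOneSpectrum (𝓞 K), w' ∉ T → (lam * ρ).IsUnramifiedAt w' := by
    intro w' hw'
    by_cases h : w' = w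
    · exact h ▸ hunrw
    · exact hunr w' (by simp [h, hw'])
  have hx : ‖avatarValueAt r γ - 1‖ < 1 := ZpExtension.norm_avatarValueAt_sub_one_lt hκ hγ
  have hE := hasValueAt_one_sub_C_mul_binomPow a (Multiplicative.toAdd (κ φ)) hx
  rw [← ZpExtension.avatarValueAt_eq_onePlusPow hκ hγ φ, ← hval] at hE
  have hprod := IntSeries.HasValueAt.mul hx hE (hG ρ r m hr hκ hm hinf hunr' hL)
  convert hprod using 1
  rw [interpolationValue₀_insert (p := p) v hw (lam * ρ) m Ω (hL.continuation 0), map_mul, map_sub,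
    map_one]
  push_cast
  ring

/-- **Pointwise form (no statement about the `w`-RAMIFIED points of the larger range)**: at ONE
interpolation point of the SMALLER range — `ε = λρ` of type `(−m,0)` unramified outside `T` (so at `w`
too), `ρ̂` through `κ` — the product `(1 − a(1+T)^{κφ})·G` takes the value prescribed by the modulus
`T ∪ {w}`, as soon as `ι⁻¹ε(ϖ_w) = a·r(φ)` at that point. This is what a RIGIDITY argument between two
candidate branches of modulus `T ∪ {w}` consumes (agreement on the infinite set of `T`-range points), and
it needs the avatar dictionary at `w` only in the direction "value at an unramified point" — not the
converse "`r` unramified at `w` ⟹ `ε` unramified at `w`" that the full predicate `insert_of_avatarAt`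
requires through its larger range. [cite: deShalit1987, II Thm. 4.12 (ii) (32) (store chunk 66–67), II.4.16 (50) and the sentence following it (store chunk 77)] -/
theorem IsNuBranch.hasValueAt_insert_of_avatarAt (hG : IsNuBranch ι v T κ γ lam Ω Ωp G)
    (hγ : κ.IsTopGenerator γ) (hw : w ∉ T) (φ : absoluteGaloisGroup K) (a : PadicComplexInt p)
    {ρ : HeckeCharacter K} {r : FramedGaloisRep K (PadicAlgCl p) 1} {m : ℕ}
    (hr : IsPAdicAvatarOf ι ρ r) (hκ : FactorsThroughZp κ r) (hm : 0 < m)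
    (hinf : (lam * ρ).HasInfinityType (fun _ ↦ -(m : ℤ)) (fun _ ↦ (0 : ℤ)))
    (hunr : ∀ w' : HeightOneSpectrum (𝓞 K), w' ∉ T → (lam * ρ).IsUnramifiedAt w')
    (hval : ((ι.symm (heckeValueExtZero (lam * ρ) w) : PadicAlgCl p) : ℂ_[p]) =
      (a : ℂ_[p]) * avatarValueAt r φ)
    (hL : LFunction.HasEntireContinuation (heckeLFunction (lam * ρ))) :
    IntSeries.HasValueAt ((1 - PowerSeries.C a * IntSeries.binomPow (Multiplicative.toAdd (κ φ))) * G)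
      (avatarValueAt r γ - 1)
      (((ι.symm (interpolationValue₀ p v (insert w T) (lam * ρ) m Ω (hL.continuation 0)) :
          PadicAlgCl p) : ℂ_[p]) * Ωp ^ m) := by
  have hx : ‖avatarValueAt r γ - 1‖ < 1 := ZpExtension.norm_avatarValueAt_sub_one_lt hκ hγ
  have hE := hasValueAt_one_sub_C_mul_binomPow a (Multiplicative.toAdd (κ φ)) hx
  rw [← ZpExtension.avatarValueAt_eq_onePlusPow hκ hγ φ, ← hval] at hE
  have hprod := IntSeries.HasValueAt.mul hx hE (hG ρ r m hr hκ hm hinf hunr hL)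
  convert hprod using 1
  rw [interpolationValue₀_insert (p := p) v hw (lam * ρ) m Ω (hL.continuation 0), map_mul, map_sub,
    map_one]
  push_cast
  ring

/-- The pointwise form at the INVERSE generator (orientation of `thm13_exists_nuBranch_charIdeal_eq`):
exponent `−κφ`. [cite: deShalit1987, II Thm. 4.12 (ii) (32) (store chunk 66–67), II.4.17 (52)–(54) (store chunk 77–78)] -/
theorem IsNuBranch.hasValueAt_insert_of_avatarAt_inv (hG : IsNuBranch ι v T κ γ⁻¹ lam Ω Ωp G)
    (hγ : κ.IsTopGenerator γ) (hw : w ∉ T) (φ : absoluteGaloisGroup K) (a : PadicComplexInt p)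
    {ρ : HeckeCharacter K} {r : FramedGaloisRep K (PadicAlgCl p) 1} {m : ℕ}
    (hr : IsPAdicAvatarOf ι ρ r) (hκ : FactorsThroughZp κ r) (hm : 0 < m)
    (hinf : (lam * ρ).HasInfinityType (fun _ ↦ -(m : ℤ)) (fun _ ↦ (0 : ℤ)))
    (hunr : ∀ w' : HeightOneSpectrum (𝓞 K), w' ∉ T → (lam * ρ).IsUnramifiedAt w')
    (hval : ((ι.symm (heckeValueExtZero (lam * ρ) w) : PadicAlgCl p) : ℂ_[p]) =
      (a : ℂ_[p]) * avatarValueAt r φ)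
    (hL : LFunction.HasEntireContinuation (heckeLFunction (lam * ρ))) :
    IntSeries.HasValueAt
      ((1 - PowerSeries.C a * IntSeries.binomPow (-(Multiplicative.toAdd (κ φ)))) * G)
      (avatarValueAt r γ⁻¹ - 1)
      (((ι.symm (interpolationValue₀ p v (insert w T) (lam * ρ) m Ω (hL.continuation 0)) :
          PadicAlgCl p) : ℂ_[p]) * Ωp ^ m) := by
  have hG' : IsNuBranch ι v T (κ.unitTwist (-1)) γ⁻¹ lam Ω Ωp G :=
    (isNuBranch_unitTwist_iff (-1)).mpr hG
  have hκ' : FactorsThroughZp (κ.unitTwist (-1)) r := (factorsThroughZp_unitTwist_iff (-1) r).mpr hκ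
  have h := hG'.hasValueAt_insert_of_avatarAt hγ.unitTwist_neg_one_inv hw φ a hr hκ' hm hinf hunr hval hL
  have hc : Multiplicative.toAdd ((κ.unitTwist (-1)) φ) = -(Multiplicative.toAdd (κ φ)) := by
    rw [ZpExtension.unitTwist_apply]
    simp
  rwa [hc] at h

/-- **The same at the INVERSE generator** (the orientation of `thm13_exists_nuBranch_charIdeal_eq`):
for `G` an `IsNuBranch ι v T κ γ⁻¹ λ Ω Ω_p` solution with `γ` a topological generator of `κ`, and the
avatar dictionary at `w` in the form `ι⁻¹ε(ϖ_w) = a·r(φ)`, the product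
`(1 − a(1+T)^{−κφ})·G` is an `IsNuBranch ι v (insert w T) κ γ⁻¹ λ Ω Ω_p` solution (`−κφ` = the
coordinate of `φ` for the `(−1)`-twisted quotient, of which `γ⁻¹` is a generator).
[cite: deShalit1987, II Thm. 4.12 (ii) (32) (store chunk 66–67), II.4.17 (52)–(54) (store chunk 77–78)]
[cite: Muller2020SplitPrimeTwo, §2 ν(𝔤) (arXiv p0006:L31–36)] -/
theorem IsNuBranch.insert_of_avatarAt_inv (hG : IsNuBranch ι v T κ γ⁻¹ lam Ω Ωp G)
    (hγ : κ.IsTopGenerator γ) (hw : w ∉ T) (φ : absoluteGaloisGroup K) (a : PadicComplexInt p)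
    (hdict : ∀ (ρ : HeckeCharacter K) (r : FramedGaloisRep K (PadicAlgCl p) 1) (m : ℕ),
      IsPAdicAvatarOf ι ρ r → FactorsThroughZp κ r → 0 < m →
      (lam * ρ).HasInfinityType (fun _ ↦ -(m : ℤ)) (fun _ ↦ (0 : ℤ)) →
      (∀ w' : HeightOneSpectrum (𝓞 K), w' ∉ insert w T → (lam * ρ).IsUnramifiedAt w') →
      (lam * ρ).IsUnramifiedAt w ∧
        ((ι.symm (heckeValueExtZero (lam * ρ) w) : PadicAlgCl p) : ℂ_[p]) =
          (a : ℂ_[p]) * avatarValueAt r φ) :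
    IsNuBranch ι v (insert w T) κ γ⁻¹ lam Ω Ωp
      ((1 - PowerSeries.C a * IntSeries.binomPow (-(Multiplicative.toAdd (κ φ)))) * G) := by
  have hG' : IsNuBranch ι v T (κ.unitTwist (-1)) γ⁻¹ lam Ω Ωp G :=
    (isNuBranch_unitTwist_iff (-1)).mpr hG
  have hdict' : ∀ (ρ : HeckeCharacter K) (r : FramedGaloisRep K (PadicAlgCl p) 1) (m : ℕ),
      IsPAdicAvatarOf ι ρ r → FactorsThroughZp (κ.unitTwist (-1)) r → 0 < m →
      (lam * ρ).HasInfinityType (fun _ ↦ -(m : ℤ)) (fun _ ↦ (0 : ℤ)) →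
      (∀ w' : HeightOneSpectrum (𝓞 K), w' ∉ insert w T → (lam * ρ).IsUnramifiedAt w') →
      (lam * ρ).IsUnramifiedAt w ∧
        ((ι.symm (heckeValueExtZero (lam * ρ) w) : PadicAlgCl p) : ℂ_[p]) =
          (a : ℂ_[p]) * avatarValueAt r φ :=
    fun ρ r m hr hκ ↦ hdict ρ r m hr ((factorsThroughZp_unitTwist_iff (-1) r).mp hκ)
  have h := hG'.insert_of_avatarAt hγ.unitTwist_neg_one_inv hw φ a hdict'
  have hc : Multiplicative.toAdd ((κ.unitTwist (-1)) φ) = -(Multiplicative.toAdd (κ φ)) := by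
    rw [ZpExtension.unitTwist_apply]
    simp
  rw [hc] at h
  exact (isNuBranch_unitTwist_iff (-1)).mp h

end Euler

end Literature.NumberTheory.EllipticCurves.Muller2020

end
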